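import Literature.Computability.ImplicitComplexity.SoftTypeAssignmentMachineLabels
import HarnessLib

/-!
# A sharing abstract machine deciding acceptance of `STA₊` programs, III: soundness of the transitions

Continuation of `SoftTypeAssignmentMachine.lean` (the Krivine-style machine `STA.KAM` with choice
oracle and two abstract binder levels; GMR08 = Gaboardi–Marion–Ronchi Della Rocca 2008, Table 6).
Each transition either leaves the represented term `KAM.rd` unchanged (push, look-up = rule `(h)`,
entering an abstraction) or performs exactly one leftmost-outermost step on it (`β`, the two
choices), and preserves well-formedness (`KAM.step_sound`); an accepting configuration represents
`0`. Hence **soundness** (`KAM.run_sound`): if the machine accepts a closed term `T` for some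
oracle within some number of transitions, then `T →βγ* 0`, i.e. `T` is accepted in the sense of
GMR08 Def. 5.13.

## References

* [GaboardiMarionRonchidellarocca2008] GMR08, §5.1, Table 6, Lemma 5.4, Def. 5.13.
-/

namespace Literature.Computability.ImplicitComplexity

namespace STA

namespace KAM

/-! ### Leftmost steps in the represented position -/

/-- A head step of the head lifts through the pending arguments. [folklore] -/
theorem Hd.apps {M M' : Term} (h : Hd M M') : ∀ (args : List Term), Hd (apps M args) (apps M' args)
  | [] => h
  | a :: as => Hd.apps (Hd.appL a h) as

/-- A leftmost step lifts under the entered abstractions. [folklore] -/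
theorem Lmo.lams {M M' : Term} (h : Lmo M M') : ∀ (D : ℕ), Lmo (lams D M) (lams D M')
  | 0 => h
  | D + 1 => Lmo.lam (Lmo.lams h D)

/-! ### Soundness of the transitions -/

section transitions

variable {o o' : List Bool} {env : List ℕ} {stack : List (Term × List ℕ)} {heap : List Entry} {depth : ℕ}
  {s' : State}

/-- Reading a new cell of an extended heap: the pointer is beyond the old heap. [folklore] -/
theorem getElem?_snoc_of_ge {heap : List Entry} {e : Entry} {c : ℕ} (hge : heap.length ≤ c) {x : Entry}
    (h : (heap ++ [e])[c]? = some x) : c = heap.length ∧ x = e := by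
  rw [List.getElem?_append_right hge] at h
  rcases Nat.eq_zero_or_pos (c - heap.length) with hz | hp
  · rw [hz] at h
    simp only [List.getElem?_cons_zero, Option.some.injEq] at h
    exact ⟨by omega, h.symm⟩
  · have : ([e] : List Entry)[c - heap.length]? = none := by
      rw [List.getElem?_eq_none_iff]; simp; omega
    rw [this] at h
    cases h

/-- Transition from an application: push the argument (silent). [folklore] -/
theorem step_app {t u : Term} (hwf : WF ⟨.app t u, env, stack, heap, depth⟩) :
    WF ⟨t, env, (u, env) :: stack, heap, depth⟩ ∧
      rd ⟨t, env, (u, env) :: stack, heap, depth⟩ = rd ⟨.app t u, env, stack, heap, depth⟩ := by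
  obtain ⟨hEnv, hCode, hStack, hHeapClo, hHeapAbs, hDepth⟩ := hwf
  dsimp only at hEnv hCode hStack hHeapClo hHeapAbs hDepth
  refine ⟨⟨hEnv, fun i hi => hCode i (by simp [hi]), ?_, hHeapClo, hHeapAbs, hDepth⟩, ?_⟩
  · intro cl hcl
    simp only [List.mem_cons] at hcl
    rcases hcl with rfl | hcl
    · exact ⟨hEnv, fun i hi => hCode i (by simp [hi])⟩
    · exact hStack cl hcl
  · simp [rd, rbClo, Term.substp, apps]

/-- Transition from an abstraction against an argument: the β-step. [cite: GaboardiMarionRonchidellarocca2008, Table 6 (β)] -/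
theorem step_beta {t : Term} {c : Term × List ℕ} {S : List (Term × List ℕ)}
    (hwf : WF ⟨.lam t, env, c :: S, heap, depth⟩) :
    WF ⟨t, heap.length :: env, S, heap ++ [Entry.clo c.1 c.2], depth⟩ ∧
      LmoL none (rd ⟨.lam t, env, c :: S, heap, depth⟩) (rd ⟨t, heap.length :: env, S, heap ++ [Entry.clo c.1 c.2], depth⟩) := by
  obtain ⟨hEnv, hCode, hStack, hHeapClo, hHeapAbs, hDepth⟩ := hwf
  dsimp only at hEnv hCode hStack hHeapClo hHeapAbs hDepth
  have hc := hStack c (by simp)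
  refine ⟨⟨?_, ?_, ?_, ?_, ?_, hDepth⟩, ?_⟩
  · intro c' hc'
    simp only [List.mem_cons, List.length_append, List.length_singleton] at hc' ⊢
    rcases hc' with rfl | hc'
    · omega
    · have := hEnv c' hc'; omega
  · intro i hi
    cases i with
    | zero => simp
    | succ i => simpa using hCode i (by simpa using hi)
  · intro cl hcl
    obtain ⟨h1, h2⟩ := hStack cl (by simp [hcl])
    exact ⟨fun c' hc' => by have := h1 c' hc'; simp; omega, h2⟩
  · intro c' t' env' hget
    rcases Nat.lt_or_ge c' heap.length with hlt | hge
    · rw [List.getElem?_append_left hlt] at hget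
      exact hHeapClo c' t' env' hget
    · obtain ⟨rfl, hx⟩ := getElem?_snoc_of_ge hge hget
      simp only [Entry.clo.injEq] at hx
      obtain ⟨rfl, rfl⟩ := hx
      exact hc
  · intro c' ℓ hget
    rcases Nat.lt_or_ge c' heap.length with hlt | hge
    · rw [List.getElem?_append_left hlt] at hget
      exact hHeapAbs c' ℓ hget
    · obtain ⟨_, hx⟩ := getElem?_snoc_of_ge hge hget
      cases hx
  · -- a β-step at the head, under the entered abstractions
    simp only [rd, List.map_cons, apps, List.length_append, List.length_singleton]
    have hnew : rbClo (heap ++ [Entry.clo c.1 c.2]) depth (heap.length + 1) t (heap.length :: env) =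
        (t.substp (Term.up (rbEnv heap depth heap.length env))).subst0 (rbClo heap depth heap.length c.1 c.2) := by
      simp only [rbClo]
      rw [substp_up_subst0]
      refine Term.substp_congr_fv fun i hi => ?_
      cases i with
      | zero =>
        simp only [rbEnv, List.getElem?_cons_zero, Option.elim]
        rw [rbCell_clo (t := c.1) (env := c.2) (by simp), rbClo, rbEnv_stable _ depth le_rfl hc.1,
          rbEnv_append _ _ _ le_rfl]
      | succ i =>
        simp only [rbEnv, List.getElem?_cons_succ]
        cases hget : env[i]? with
        | none =>
          have := hCode i (by simpa using hi)
          exact absurd hget (by rw [List.getElem?_eq_none_iff]; omega)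
        | some c' =>
          have hc' : c' < heap.length := hEnv c' (List.mem_of_getElem? hget)
          simp only [Option.elim]
          rw [rbCell_stable _ depth hc' _ (by omega), rbCell_append _ _ _ _ le_rfl]
    have hstack : (S.map fun cl => rbClo (heap ++ [Entry.clo c.1 c.2]) depth (heap.length + 1) cl.1 cl.2) =
        S.map fun cl => rbClo heap depth heap.length cl.1 cl.2 := by
      refine List.map_congr_left fun cl hcl => ?_
      obtain ⟨h1, _⟩ := hStack cl (by simp [hcl])
      rw [rbClo, rbClo, rbEnv_stable _ depth (Nat.le_succ _) h1, rbEnv_append _ _ _ le_rfl]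
    rw [hnew, hstack]
    refine LmoL.lams (LmoL.hd (HdL.apps ?_ _)) depth
    simp only [rbClo, Term.substp]
    exact HdL.beta _ _

/-- Transition from an abstraction with empty stack: enter it (depth `< 2`).
[cite: GaboardiMarionRonchidellarocca2008, Table 6 (λ)] -/
theorem step_enter {t : Term} (hwf : WF ⟨.lam t, env, [], heap, depth⟩) (hd : depth < 2) :
    WF ⟨t, heap.length :: env, [], heap ++ [Entry.abs depth], depth + 1⟩ ∧
      rd ⟨t, heap.length :: env, [], heap ++ [Entry.abs depth], depth + 1⟩ = rd ⟨.lam t, env, [], heap, depth⟩ := by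
  obtain ⟨hEnv, hCode, hStack, hHeapClo, hHeapAbs, hDepth⟩ := hwf
  dsimp only at hEnv hCode hStack hHeapClo hHeapAbs hDepth
  · refine ⟨⟨?_, ?_, by simp, ?_, ?_, by show depth + 1 ≤ 2; omega⟩, ?_⟩
    · intro c' hc'
      simp only [List.mem_cons, List.length_append, List.length_singleton] at hc' ⊢
      rcases hc' with rfl | hc'
      · omega
      · have := hEnv c' hc'; omega
    · intro i hi
      cases i with
      | zero => simp
      | succ i => simpa using hCode i (by simpa using hi)
    · intro c' t' env' hget
      rcases Nat.lt_or_ge c' heap.length with hlt | hge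
      · rw [List.getElem?_append_left hlt] at hget
        exact hHeapClo c' t' env' hget
      · obtain ⟨_, hx⟩ := getElem?_snoc_of_ge hge hget
        cases hx
    · intro c' ℓ hget
      rcases Nat.lt_or_ge c' heap.length with hlt | hge
      · rw [List.getElem?_append_left hlt] at hget
        have := hHeapAbs c' ℓ hget
        show ℓ < depth + 1
        omega
      · obtain ⟨_, hx⟩ := getElem?_snoc_of_ge hge hget
        simp only [Entry.abs.injEq] at hx
        subst hx
        show ℓ < ℓ + 1
        omega
    · -- entering the abstraction does not change the represented term:
      -- the new environment at depth `D+1` is the lift of the old one at depth `D`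
      have key : ∀ n, n ≤ heap.length → ∀ c', c' < n →
          rbCell (heap ++ [Entry.abs depth]) (depth + 1) n c' = (rbCell heap depth n c').rename Nat.succ := by
        intro n
        induction n with
        | zero => intro _ c' hc'; omega
        | succ n ih =>
          intro hn c' hc'
          simp only [rbCell]
          have hget : (heap ++ [Entry.abs depth])[n]? = heap[n]? := List.getElem?_append_left (by omega)
          rw [hget]
          by_cases hcn : c' = n
          · simp only [hcn, if_true]
            rcases hh : heap[n]? with _ | ⟨t', env'⟩ | ℓ
            · rfl
            · obtain ⟨h1, h2⟩ := hHeapClo n t' env' hh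
              simp only [Term.rename_substp]
              refine Term.substp_congr_fv fun i hi => ?_
              have hi' := h2 i hi
              cases hget' : env'[i]? with
              | none => exact absurd hget' (by rw [List.getElem?_eq_none_iff]; omega)
              | some c'' =>
                simp only [Option.elim]
                exact ih (by omega) c'' (h1 c'' (List.mem_of_getElem? hget'))
            · have := hHeapAbs n ℓ hh
              simp only [Term.rename, Term.var.injEq]
              omega
          · rw [if_neg hcn, if_neg hcn]
            exact ih (by omega) c' (by omega)
      have hσ : rbEnv (heap ++ [Entry.abs depth]) (depth + 1) (heap.length + 1) (heap.length :: env) =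
          Term.up (rbEnv heap depth heap.length env) := by
        funext i
        cases i with
        | zero =>
          simp only [rbEnv, List.getElem?_cons_zero, Term.up, Option.elim]
          rw [rbCell_abs (ℓ := depth) (by simp)]
          simp
        | succ i =>
          simp only [rbEnv, List.getElem?_cons_succ, Term.up]
          cases hget : env[i]? with
          | none => rfl
          | some c' =>
            have hc' : c' < heap.length := hEnv c' (List.mem_of_getElem? hget)
            simp only [Option.elim]
            rw [rbCell_stable _ (depth + 1) hc' _ (by omega), key heap.length le_rfl c' hc']
      simp only [rd, List.map_nil, apps, List.length_append, List.length_singleton, rbClo, Term.substp, hσ,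
        lams_lam]

/-- Transition from a sum: follow the oracle. [cite: GaboardiMarionRonchidellarocca2008, Table 6 ((L), (R))] -/
theorem step_sum {t u : Term} (hwf : WF ⟨.sum t u, env, stack, heap, depth⟩) (b : Bool) :
    WF ⟨if b then u else t, env, stack, heap, depth⟩ ∧
      LmoL (some b) (rd ⟨.sum t u, env, stack, heap, depth⟩) (rd ⟨if b then u else t, env, stack, heap, depth⟩) := by
  obtain ⟨hEnv, hCode, hStack, hHeapClo, hHeapAbs, hDepth⟩ := hwf
  dsimp only at hEnv hCode hStack hHeapClo hHeapAbs hDepth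
  refine ⟨⟨hEnv, fun i hi => hCode i ?_, hStack, hHeapClo, hHeapAbs, hDepth⟩, ?_⟩
  · cases b <;> simp_all
  · simp only [rd]
    refine LmoL.lams (LmoL.hd (HdL.apps ?_ _)) depth
    cases b
    · simpa [rbClo, Term.substp] using HdL.choiceL _ _
    · simpa [rbClo, Term.substp] using HdL.choiceR _ _

/-- Transition from a variable: look it up (rule `(h)`), or halt. [cite: GaboardiMarionRonchidellarocca2008, Table 6 (h)] -/
theorem step_var {i c : ℕ} {t' : Term} {env' : List ℕ} (hwf : WF ⟨.var i, env, stack, heap, depth⟩)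
    (hget : env[i]? = some c) (hcell : heap[c]? = some (Entry.clo t' env')) :
    WF ⟨t', env', stack, heap, depth⟩ ∧ rd ⟨t', env', stack, heap, depth⟩ = rd ⟨.var i, env, stack, heap, depth⟩ := by
  obtain ⟨hEnv, hCode, hStack, hHeapClo, hHeapAbs, hDepth⟩ := hwf
  dsimp only at hEnv hCode hStack hHeapClo hHeapAbs hDepth
  have hc : c < heap.length := hEnv c (List.mem_of_getElem? hget)
  obtain ⟨h1, h2⟩ := hHeapClo c t' env' hcell
  refine ⟨⟨fun c' hc' => (h1 c' hc').trans hc, h2, hStack, hHeapClo, hHeapAbs, hDepth⟩, ?_⟩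
  simp only [rd]
  congr 2
  simp only [rbClo, Term.substp, rbEnv, hget, Option.elim]
  rw [rbCell_eq_succ heap depth hc, rbCell_clo hcell, rbClo, rbEnv_stable heap depth hc.le h1]

end transitions

/-- **One transition either keeps the represented term or performs one leftmost step on it, and
preserves well-formedness.** [cite: GaboardiMarionRonchidellarocca2008, Lemma 5.4] -/
theorem step_sound {o o' : List Bool} {s s' : State} (hwf : WF s) (h : step o s = .go o' s') :
    WF s' ∧ (rd s' = rd s ∨ Lmo (rd s) (rd s')) := by
  obtain ⟨code, env, stack, heap, depth⟩ := s
  cases code with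
  | app t u =>
    simp only [step, Res.go.injEq] at h
    obtain ⟨rfl, rfl⟩ := h
    exact ⟨(step_app hwf).1, Or.inl (step_app hwf).2⟩
  | lam t =>
    cases stack with
    | cons c S =>
      simp only [step, Res.go.injEq] at h
      obtain ⟨rfl, rfl⟩ := h
      exact ⟨(step_beta hwf).1, Or.inr (step_beta hwf).2.lmo⟩
    | nil =>
      simp only [step] at h
      by_cases hd : depth < 2
      · rw [if_pos hd] at h
        simp only [Res.go.injEq] at h
        obtain ⟨rfl, rfl⟩ := h
        exact ⟨(step_enter hwf hd).1, Or.inl (step_enter hwf hd).2⟩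
      · rw [if_neg hd] at h
        cases h
  | sum t u =>
    cases o with
    | nil => simp [step] at h
    | cons b o₀ =>
      simp only [step, Res.go.injEq] at h
      obtain ⟨rfl, rfl⟩ := h
      exact ⟨(step_sum hwf b).1, Or.inr (step_sum hwf b).2.lmo⟩
  | var i =>
    rcases hget : env[i]? with _ | c
    · simp [step, hget] at h
    · rcases hcell : heap[c]? with _ | ⟨t', env'⟩ | ℓ
      · simp [step, hget, hcell] at h
      · simp only [step, hget, hcell, Res.go.injEq] at h
        obtain ⟨rfl, rfl⟩ := h
        exact ⟨(step_var hwf hget hcell).1, Or.inl (step_var hwf hget hcell).2⟩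
      · simp only [step, hget, hcell] at h
        split_ifs at h

/-- The represented term of the initial state is the term. [folklore] -/
theorem rd_init (T : Term) : rd (init T) = T := by
  have : rbEnv [] 0 0 [] = Term.var := by
    funext i
    simp [rbEnv]
  simp only [rd, init, lams, apps, List.map_nil, rbClo, List.length_nil, this, Term.substp_var]

/-- In an accepting configuration the represented term is `0`. [folklore] -/
theorem rd_accept {o : List Bool} {s : State} (hwf : WF s) (h : step o s = .accept) : rd s = zero := by
  obtain ⟨code, env, stack, heap, depth⟩ := s
  obtain ⟨hEnv, hCode, hStack, hHeapClo, hHeapAbs, hDepth⟩ := hwf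
  dsimp only at hEnv hCode hStack hHeapClo hHeapAbs hDepth
  cases code with
  | app t u => simp [step] at h
  | lam t =>
    cases stack with
    | cons c S => simp [step] at h
    | nil =>
      simp only [step] at h
      split_ifs at h
  | sum t u => cases o <;> simp [step] at h
  | var i =>
    rcases hget : env[i]? with _ | c
    · simp [step, hget] at h
    · rcases hcell : heap[c]? with _ | ⟨t', env'⟩ | ℓ
      · simp [step, hget, hcell] at h
      · simp [step, hget, hcell] at h
      · simp only [step, hget, hcell] at h
        split_ifs at h with hcond
        obtain ⟨hS, hD, hℓ⟩ := hcond
        have hS' : stack = [] := List.isEmpty_iff.1 hS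
        subst hS' hD hℓ
        have hc : c < heap.length := hEnv c (List.mem_of_getElem? hget)
        simp only [rd, List.map_nil, apps, rbClo, Term.substp, rbEnv, hget, Option.elim]
        rw [rbCell_eq_succ heap 2 hc, rbCell_abs hcell]
        rfl

/-- **Soundness of the machine.** If the machine accepts a closed term `T` for some oracle, then
`0` is a `βγ`-normal form of `T` (indeed reached by leftmost-outermost steps).
[cite: GaboardiMarionRonchidellarocca2008, Lemma 5.4] -/
theorem run_sound {T : Term} (hT : T.fv = ∅) {n : ℕ} {o : List Bool} (h : run n o (init T) = true) :
    Reduces T zero := by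
  suffices H : ∀ n o s, WF s → run n o s = true → Reduces (rd s) zero by
    simpa [rd_init] using H n o (init T) (WF.init hT) h
  intro n
  induction n with
  | zero => intro o s _ h; simp [run] at h
  | succ n ih =>
    intro o s hwf h
    simp only [run] at h
    rcases hs : step o s with ⟨o', s'⟩ | _ | _
    · rw [hs] at h
      obtain ⟨hwf', hrd⟩ := step_sound hwf hs
      have := ih o' s' hwf' h
      rcases hrd with e | hl
      · rwa [e] at this
      · exact (Relation.ReflTransGen.single hl.red).trans this
    · rw [rd_accept hwf hs]
      exact Relation.ReflTransGen.refl
    · simp [hs] at h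

end KAM

end STA

end Literature.Computability.ImplicitComplexity
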